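import Literature.NumberTheory.EllipticCurves.RankinSelbergLFunctionK
import Literature.NumberTheory.GaloisRepresentations.ArtinReciprocityCharacter
import Literature.NumberTheory.GaloisRepresentations.ArtinLFunctionDirichletProofs
import Literature.NumberTheory.GaloisRepresentations.AbsIntegersEquiv
import Literature.NumberTheory.Automorphic.ReciprocityGLnDescentProofs
import Literature.NumberTheory.EllipticCurves.BSDConductorProofs
import HarnessLib

/-!
# Route `SchneiderFreeAdditiveX3` (K1 door), cruxes `PotMultBranchIMC` / `GordTwoBranchIMC`
# (items stmt-BirchSwinnertonDyer-19176 / 19177): `heckeValueAt` in GALOIS currency — FILE 1 of W2: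
# `χ(Frob_v)` / `0`, and Dirichlet characters through the cyclotomic character

Cell `bsd-schneider-ideate`, seat `bsd-schneider-door-c4` (prover, generation 8). HONEST FRAMING:
theorems only (no definition, no named fact, nothing asserted about BSD; both cruxes stay OPEN).
This is the Galois half of want **W2** of `FINDING-door-c2-g8.md` §2 — the ARTIN LINK
`L′(f_V, χ, 1) = L′(E/K, 1)` for the genus character `χ = ε` of conductor `p` on the (M) cell, where
the tree's cite-only `Gross2004.rankinLSeries_eq_mul_quadraticTwist` (vendored WITH `(c, N) = 1`) does
not apply (`c = p ∥ N_V`), so that door-c2 g8's frame theorems carry it as the hypothesis `hArtin`.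

The tree's Rankin–Selberg `L`-function in GALOIS currency, `rankinSelbergEulerProduct f χ_gal s`
(`RankinSelbergLFunctionK.lean`, Nekovář 1995 (0.5)), is built from `heckeValueAt χ_gal v` :=
minus the linear coefficient of the rank-one Artin Euler factor of `χ_gal` at `v` — a definition
that, before this file, had NO proved API (every Galois-currency consumer in the tree is fed by a
cite-only fact: Gross 2004, Cai–Shu–Tian 2014 Thm 1.1/1.5, Castella 2018). Here:

* §1 `heckeValueAt_eq_of_isUnramifiedAt` / `heckeValueAt_eq_zero_of_not_isUnramifiedAt`:
  `heckeValueAt χ v = χ(Frob_v)` at an unramified place (any arithmetic Frobenius at any `𝔓 ∣ v`),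
  `= 0` at a ramified one — from the tree's rank-one Euler factor theorems
  (`FramedArtinRep.eval_eulerFactorAt_of_isUnramifiedAt`, `…eq_one_of_not_isUnramifiedAt`,
  Neukirch VII §10 proof of (10.6)).
* §2 for a Dirichlet character `θ` mod `m` read through the cyclotomic character
  (`dirichletGaloisCharacter K θ = θ ∘ χ_m`): UNRAMIFIED at `v ∤ m` with value `θ(N v)`
  (`heckeValueAt_dirichletGaloisCharacter_of_not_mem`; tree `modNCyclotomicCharacter_eq_one_of_mem_inertia`,
  `…_eq_residueCard_of_isArithFrobAt`), and for `m = p` prime, `θ` non-trivial and `p` UNRAMIFIED in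
  the Galois field `K`: RAMIFIED above `p`, value `0` (`heckeValueAt_dirichletGaloisCharacter_of_mem`;
  an absolute inertia element with prescribed `χ_p` — tree `exists_mem_inertia_modNCyclotomicCharacter_eq`
  — lifted to `Γ_K` by `inertia_le_range_absGaloisRestrict` and `comap_inertia_comap_absIntegersMap`).
(FILE 2, `…GenusCharacterValues.lean`:)
* §3 `eq_dirichletGaloisCharacter_jacobiChar_of_isRationalCharacterFor`: a character `χ_gal` of `Γ_K`
  which is RATIONAL for `p*` in Gross's sense (`χ_gal(γ) = +1` iff `γ` fixes `√p*`; on the door this is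
  the genus character, `isRationalCharacterFor_of_genusDatum`) IS `(·/p) ∘ χ_p` — via the quadratic
  Gauss sum `g ∈ K̄`, `g² = p*`, `γ g = (χ_p(γ)/p) g` (`exists_gaussSum_pStar`, Mathlib `gaussSum_sq`,
  `gaussSum_mulShift`).
* §4 `heckeValueAt_genus_of_not_mem` / `heckeValueAt_genus_of_mem`: hence for the genus character
  `heckeValueAt χ_gal v = (N v / p)` at `v ∤ p` and `= 0` at `v ∣ p` (given one prime of `K` over `p`
  with `e = 1`, e.g. `p` split) — EXACTLY the Hecke-currency values `θ(ℓ)^{f_v}` of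
  `ψ_θ ∘ N_{K/ℚ}` in bsd-addord's PROVED Artin formalism
  (`rankinSelbergEulerProductHecke_baseChangeDirichlet_eq_holds`), and the input of the companion file
  `…ArtinLinkGenus.lean` (the Euler-product identity `L(f_V ⊗ K, χ_gal, s) = L(W_K, s)` and the
  derivative identity).

References: Nekovář, Math. Ann. 302 (1995) (0.5), §3.4, (3.2.1); Neukirch, *Algebraic Number
Theory* I §9 (9.6), I (10.3)–(10.4), VII §10 (10.6); Serre, *Local Fields* I §7 Prop. 22(b);
Ireland–Rosen, Prop. 6.3.2 (Gauss sum); Gross, MSRI Publ. 49 (2004) §2–§3 (rational / genus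
characters).
-/

noncomputable section

open scoped NumberField
open Field IsDedekindDomain NumberField Polynomial
open Literature.NumberTheory.GaloisRepresentations

-- D-0017 layout: summit = sub-problem, so `Summit.BirchSwinnertonDyer.BirchSwinnertonDyer.…` is the
-- mandated namespace (same option as the route's sockets files).
set_option linter.dupNamespace false
set_option autoImplicit false

namespace Summit.BirchSwinnertonDyer.BirchSwinnertonDyer.Theorems.SchneiderFree

open Literature.NumberTheory.EllipticCurves

universe u

variable {K : Type u} [Field K] [NumberField K]

/-! ## §1 `heckeValueAt` through the rank-one Euler factor -/

omit [NumberField K] in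
/-- Entries of a `1 × 1` invertible matrix: `det g = g 0 0`. [folklore] -/
theorem det_ofCharacter_apply (χ : absoluteGaloisGroup K →ₜ* ℂˣ) (σ : absoluteGaloisGroup K) :
    (FramedRep.det (FramedRep.ofCharacter χ) σ : ℂ) = (χ σ : ℂ) := by
  rw [FramedRep.det_apply, Matrix.GeneralLinearGroup.val_det_apply, Matrix.det_fin_one,
    FramedRep.ofCharacter_apply_coe]

omit [NumberField K] in
/-- `ofCharacter χ` is unramified at `v` iff `χ` kills every inertia group above `v`. [folklore] -/
theorem isUnramifiedAt_ofCharacter_iff (χ : absoluteGaloisGroup K →ₜ* ℂˣ)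
    (v : HeightOneSpectrum (𝓞 K)) :
    GaloisRep.IsUnramifiedAt v (FramedArtinRep.toArtinRep (FramedRep.ofCharacter χ)) ↔
      ∀ 𝔓 ∈ v.primesAbove, ∀ σ ∈ 𝔓.inertia (absoluteGaloisGroup K), χ σ = 1 := by
  rw [show GaloisRep.IsUnramifiedAt v (FramedArtinRep.toArtinRep (FramedRep.ofCharacter χ)) ↔
      FramedGaloisRep.IsUnramifiedAt v (FramedRep.ofCharacter χ) from
    FramedGaloisRep.isUnramifiedAt_toGaloisRep_iff v _]
  refine forall₂_congr fun 𝔓 _ => forall₂_congr fun σ _ => ?_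
  constructor
  · intro h
    have := congrArg (fun M : GL (Fin 1) ℂ => (M : Matrix (Fin 1) (Fin 1) ℂ) 0 0) h
    simp only [FramedRep.ofCharacter_apply_coe, Units.val_one, Matrix.one_apply_eq] at this
    exact Units.ext this
  · intro h
    change FramedRep.unitsContinuousMulEquivOfUnique (Fin 1) ℂ (χ σ) = 1
    rw [h, map_one]

/-- **`heckeValueAt` at an unramified place is the value at Frobenius.** If `χ` (as the rank-one
Artin representation `ofCharacter χ`) is unramified at `v`, then for every prime `𝔓 ∣ v` of
`\bar ℤ_K` and every arithmetic Frobenius `σ` at `𝔓`: `heckeValueAt χ v = χ(σ)` — the printed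
"`𝒲(λ) = 𝒲(φ_λ)`, arithmetic Frobenius" (Nekovář 1995, (0.5); Neukirch VII §10, proof of (10.6):
`L_𝔭(χ, T) = 1 − χ(φ_𝔓) T`). [cite: NeukirchANT1999, Ch. VII §10 Thm. (10.6) (proof)] -/
theorem heckeValueAt_eq_of_isUnramifiedAt (χ : absoluteGaloisGroup K →ₜ* ℂˣ)
    {v : HeightOneSpectrum (𝓞 K)}
    (hur : GaloisRep.IsUnramifiedAt v (FramedArtinRep.toArtinRep (FramedRep.ofCharacter χ)))
    {𝔓 : Ideal (absIntegers (𝓞 K) K)} (h𝔓 : 𝔓 ∈ v.primesAbove) {σ : absoluteGaloisGroup K}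
    (hσ : IsArithFrobAt (𝓞 K) σ 𝔓) :
    heckeValueAt χ v = (χ σ : ℂ) := by
  set P := ArtinRep.eulerFactorAt (FramedArtinRep.toArtinRep (FramedRep.ofCharacter χ)) v with hP
  have hev : ∀ t : ℂ, P.eval t = 1 - (χ σ : ℂ) * t := fun t ↦ by
    rw [hP, FramedArtinRep.eval_eulerFactorAt_of_isUnramifiedAt _ hur h𝔓 hσ t,
      det_ofCharacter_apply]
  have hPeq : P = C 1 - C (χ σ : ℂ) * X := by
    refine Polynomial.funext fun t ↦ ?_
    rw [hev t, eval_sub, eval_C, eval_mul, eval_C, eval_X]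
  rw [heckeValueAt, ← hP, hPeq]
  simp [Polynomial.coeff_one]

/-- **`heckeValueAt` at a ramified place is `0`** ("extended by zero to ideals that are not prime
to `𝔣`": the Euler factor is `1`). [cite: Nekovar1995, §3.4]
[cite: NeukirchANT1999, Ch. VII §10 Thm. (10.6) (proof)] -/
theorem heckeValueAt_eq_zero_of_not_isUnramifiedAt (χ : absoluteGaloisGroup K →ₜ* ℂˣ)
    {v : HeightOneSpectrum (𝓞 K)}
    (h : ¬ GaloisRep.IsUnramifiedAt v (FramedArtinRep.toArtinRep (FramedRep.ofCharacter χ))) :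
    heckeValueAt χ v = 0 := by
  rw [heckeValueAt, FramedArtinRep.eulerFactorAt_eq_one_of_not_isUnramifiedAt _ h]
  simp [Polynomial.coeff_one]

/-! ## §2 A Dirichlet character through the cyclotomic character: values at `v ∤ m` -/

section Dirichlet

variable {m : ℕ} [NeZero m]

omit [NumberField K] [NeZero m] in
/-- For a prime `𝔓` of `\bar ℤ_K` above a finite place `v` of `K` with `m ∉ v`: `m ∉ 𝔓`
(`𝔓 ∩ 𝓞_K = v`). [folklore] -/
theorem natCast_not_mem_of_mem_primesAbove {v : HeightOneSpectrum (𝓞 K)}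
    (hv : (m : 𝓞 K) ∉ v.asIdeal) {𝔓 : Ideal (absIntegers (𝓞 K) K)} (h𝔓 : 𝔓 ∈ v.primesAbove) :
    (m : absIntegers (𝓞 K) K) ∉ 𝔓 := by
  intro hmem
  apply hv
  have h1 : (m : 𝓞 K) ∈ 𝔓.under (𝓞 K) := by
    rw [Ideal.under_def, Ideal.mem_comap, map_natCast]
    exact hmem
  rwa [← h𝔓.2.over] at h1

/-- **`θ ∘ χ_m` is unramified at `v ∤ m`.** For a Dirichlet character `θ` mod `m` read as a
character of `Γ_K` through the mod-`m` cyclotomic character (`dirichletGaloisCharacter K θ`) and a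
finite place `v` of `K` with `m ∉ v`: every inertia group above `v` acts trivially (the cyclotomic
character is unramified outside `m`, tree `modNCyclotomicCharacter_eq_one_of_mem_inertia`).
[cite: NeukirchANT1999, Ch. I (10.3)–(10.4)] -/
theorem isUnramifiedAt_dirichletGaloisCharacter (θ : DirichletCharacter ℂ m)
    {v : HeightOneSpectrum (𝓞 K)} (hv : (m : 𝓞 K) ∉ v.asIdeal) :
    GaloisRep.IsUnramifiedAt v
      (FramedArtinRep.toArtinRep (FramedRep.ofCharacter (dirichletGaloisCharacter K θ))) := by
  rw [isUnramifiedAt_ofCharacter_iff]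
  intro 𝔓 h𝔓 σ hσ
  haveI : 𝔓.IsPrime := h𝔓.1
  have h1 := modNCyclotomicCharacter_eq_one_of_mem_inertia (K := K) (N := m)
    (natCast_not_mem_of_mem_primesAbove hv h𝔓) hσ
  apply Units.ext
  rw [coe_dirichletGaloisCharacter_apply, h1, Units.val_one, map_one, Units.val_one]

/-- **`(θ ∘ χ_m)(Frob_v) = θ(N v)` at `v ∤ m`**: the Galois-currency value "extended by zero" of the
character `θ ∘ χ_m` of `Γ_K` at a finite place `v` with `m ∉ v` is `θ(N v)` — Nekovář's
"`α ∘ N`" ((3.2.1)): the cyclotomic character of an arithmetic Frobenius at `v` is `N v`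
(tree `modNCyclotomicCharacter_eq_residueCard_of_isArithFrobAt`). [cite: Nekovar1995, (3.2.1)]
[cite: NeukirchANT1999, Ch. I (10.3)] -/
theorem heckeValueAt_dirichletGaloisCharacter_of_not_mem (θ : DirichletCharacter ℂ m)
    {v : HeightOneSpectrum (𝓞 K)} (hv : (m : 𝓞 K) ∉ v.asIdeal) :
    heckeValueAt (dirichletGaloisCharacter K θ) v = θ (v.residueCard : ZMod m) := by
  obtain ⟨𝔓, h𝔓⟩ := v.primesAbove_nonempty
  obtain ⟨σ, hσ⟩ := HeightOneSpectrum.exists_isArithFrobAt_of_mem_primesAbove_holds h𝔓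
  rw [heckeValueAt_eq_of_isUnramifiedAt _ (isUnramifiedAt_dirichletGaloisCharacter θ hv) h𝔓 hσ,
    coe_dirichletGaloisCharacter_apply,
    modNCyclotomicCharacter_eq_residueCard_of_isArithFrobAt (K := K) (N := m) h𝔓
      (natCast_not_mem_of_mem_primesAbove hv h𝔓) hσ]


/-- The mod `m` cyclotomic character is compatible with the restriction `Γ_K → Γ_ℚ` along the
chosen embedding `ℚ̄ → K̄` (both sides are pinned down by the action on a primitive `m`-th root of
unity; cf. the tree's `modNCyclotomicCharacter_absGaloisRestrict`, restated here to keep the local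
Tate files out of the import cone). [folklore] -/
theorem modNCyclotomicCharacter_absGaloisRestrict_rat (σ : absoluteGaloisGroup K) :
    modNCyclotomicCharacter ℚ m (absGaloisRestrict ℚ K σ) = modNCyclotomicCharacter K m σ := by
  haveI : NeZero ((m : ℕ) : AlgebraicClosure ℚ) :=
    NeZero.nat_of_injective (algebraMap ℚ (AlgebraicClosure ℚ)).injective
  obtain ⟨ζ, hζ⟩ := HasEnoughRootsOfUnity.exists_primitiveRoot (AlgebraicClosure ℚ) m
  have hζ' : IsPrimitiveRoot (absClosureEmbedding ℚ K ζ) m :=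
    hζ.map_of_injective (absClosureEmbedding ℚ K).injective
  have h2 := modNCyclotomicCharacter_spec K m σ (absClosureEmbedding ℚ K ζ) hζ'.pow_eq_one
  rw [← map_pow, ← absGaloisRestrict_apply_smul] at h2
  have h3 : absGaloisRestrict ℚ K σ • ζ = ζ ^ ((modNCyclotomicCharacter K m σ : ZMod m)).val :=
    (absClosureEmbedding ℚ K).injective h2
  ext
  rw [modNCyclotomicCharacter_eq_of_smul_eq_pow ℚ m hζ _ h3, ZMod.natCast_val, ZMod.cast_id', id]

/-- **`θ ∘ χ_p` is RAMIFIED above `p` when `θ` is a non-trivial character mod `p` and `p` is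
unramified in the Galois number field `K`.** For a prime `p` having a prime `𝔭 ∋ p` of `K` with
`e(𝔭|p) = 1` (so `e(p, K/ℚ) = 1`, `K/ℚ` Galois), a Dirichlet character `θ` mod `p` with `θ(a) ≠ 1`
for some unit `a`, and ANY place `w ∣ p` of `K`: some inertia element above `w` is NOT killed by
`θ ∘ χ_p`. Proof: an absolute inertia element `τ₀ ∈ I_{𝔓₀} ≤ Γ_ℚ` with `χ_p(τ₀) = a` exists
(`ℚ(μ_p)/ℚ` totally ramified at `p`; tree `exists_mem_inertia_modNCyclotomicCharacter_eq`), lies in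
the image of `Γ_K` because `p` is unramified in `K` (tree `inertia_le_range_absGaloisRestrict`,
Neukirch I (9.6)), and its lift lies in the inertia group of the prime of `\bar ℤ_K` whose
contraction is `𝔓₀` (`comap_inertia_comap_absIntegersMap`).
[cite: NeukirchANT1999, Ch. I §9 (9.6) and (10.3)–(10.4)] [cite: SerreLocalFields1979, Ch. I §7 Prop. 22(b)] -/
theorem not_isUnramifiedAt_dirichletGaloisCharacter_of_mem [IsGalois ℚ K] {p : ℕ} [Fact p.Prime]
    (θ : DirichletCharacter ℂ p) {a : (ZMod p)ˣ} (ha : θ a ≠ 1)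
    (hunr : ∃ 𝔭 : HeightOneSpectrum (𝓞 K), ((p : ℕ) : 𝓞 K) ∈ 𝔭.asIdeal ∧
      𝔭.asIdeal.ramificationIdx (𝓞 ℚ) = 1)
    {w : HeightOneSpectrum (𝓞 K)} (hw : ((p : ℕ) : 𝓞 K) ∈ w.asIdeal) :
    ¬ GaloisRep.IsUnramifiedAt w
      (FramedArtinRep.toArtinRep (FramedRep.ofCharacter (dirichletGaloisCharacter K θ))) := by
  rw [isUnramifiedAt_ofCharacter_iff]
  push Not
  have hp : p.Prime := Fact.out
  obtain ⟨𝔔, h𝔔⟩ := w.primesAbove_nonempty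
  haveI : 𝔔.IsPrime := h𝔔.1
  -- the place `v₀` of `ℚ` at `p`; every place of `K` containing `p` lies over it
  set v₀ : HeightOneSpectrum (𝓞 ℚ) := (Rat.HeightOneSpectrum.primesEquiv (R := 𝓞 ℚ)).symm ⟨p, hp⟩
    with hv₀
  have hover : ∀ u : HeightOneSpectrum (𝓞 K), ((p : ℕ) : 𝓞 K) ∈ u.asIdeal →
      u.asIdeal.under (𝓞 ℚ) = v₀.asIdeal := by
    intro u hu
    have hmem : ((p : ℕ) : 𝓞 ℚ) ∈ (u.under (𝓞 ℚ)).asIdeal := by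
      rw [HeightOneSpectrum.under_asIdeal, Ideal.under_def, Ideal.mem_comap, map_natCast]
      exact hu
    rw [← HeightOneSpectrum.under_asIdeal, (natCast_mem_asIdeal_iff_eq_primesEquiv_symm _ hp).mp hmem]
  -- `p` is unramified in the Galois extension `K/ℚ`
  have hIn : v₀.asIdeal.ramificationIdxIn (𝓞 K) = 1 := by
    obtain ⟨𝔭, h𝔭, he⟩ := hunr
    haveI : 𝔭.asIdeal.LiesOver v₀.asIdeal := ⟨(hover 𝔭 h𝔭).symm⟩
    haveI : Module.Finite (𝓞 ℚ) (𝓞 K) := IsIntegralClosure.finite (𝓞 ℚ) ℚ K (𝓞 K)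
    haveI : IsGaloisGroup (K ≃ₐ[ℚ] K) (𝓞 ℚ) (𝓞 K) :=
      IsGaloisGroup.of_isFractionRing (K ≃ₐ[ℚ] K) (𝓞 ℚ) (𝓞 K) ℚ K
    rw [Ideal.ramificationIdxIn_eq_ramificationIdx v₀.asIdeal 𝔭.asIdeal (K ≃ₐ[ℚ] K)]
    exact he
  -- the contraction `𝔓₀ = ι⁻¹ 𝔔` of `𝔔` to `\bar ℤ`, above `v₀`
  have h𝔓₀ : 𝔔.comap (absIntegersMap ℚ K) ∈ v₀.primesAbove :=
    comap_absIntegersMap_mem_primesAbove (hover w hw) h𝔔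
  have hgen : Rat.HeightOneSpectrum.natGenerator v₀ = p := by
    change ((Rat.HeightOneSpectrum.primesEquiv v₀ : Nat.Primes) : ℕ) = p
    rw [hv₀, Equiv.apply_symm_apply]
  -- an absolute inertia element with `χ_p = a`
  have hm : p = p ^ (0 + 1) * 1 := by rw [zero_add, pow_one, mul_one]
  have ha1 : ZMod.unitsMap (Dvd.intro_left _ hm.symm) a = 1 := Subsingleton.elim _ _
  obtain ⟨τ₀, hτ₀I, hτ₀χ⟩ :=
    exists_mem_inertia_modNCyclotomicCharacter_eq (v := v₀) hm hp.not_dvd_one hgen h𝔓₀ ha1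
  -- it comes from `Γ_K` and lies in `I_𝔔`
  obtain ⟨τ, rfl⟩ :=
    Literature.NumberTheory.GaloisRepresentations.inertia_le_range_absGaloisRestrict ℚ K hIn h𝔓₀ hτ₀I
  have hτI : τ ∈ 𝔔.inertia (absoluteGaloisGroup K) := by
    rw [← comap_inertia_comap_absIntegersMap ℚ K 𝔔, Subgroup.mem_comap]
    exact hτ₀I
  have hτχ : modNCyclotomicCharacter ℚ p (absGaloisRestrict ℚ K τ) = a := hτ₀χ
  refine ⟨𝔔, h𝔔, τ, hτI, fun h ↦ ha ?_⟩
  have hval : ((dirichletGaloisCharacter K θ τ : ℂˣ) : ℂ) = 1 := by rw [h, Units.val_one]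
  rw [coe_dirichletGaloisCharacter_apply, ← modNCyclotomicCharacter_absGaloisRestrict_rat, hτχ]
    at hval
  exact hval

/-- Consequently `heckeValueAt (θ ∘ χ_p) w = 0` above `p` (extension by zero at a ramified place).
[cite: Nekovar1995, §3.4] -/
theorem heckeValueAt_dirichletGaloisCharacter_of_mem [IsGalois ℚ K] {p : ℕ} [Fact p.Prime]
    (θ : DirichletCharacter ℂ p) {a : (ZMod p)ˣ} (ha : θ a ≠ 1)
    (hunr : ∃ 𝔭 : HeightOneSpectrum (𝓞 K), ((p : ℕ) : 𝓞 K) ∈ 𝔭.asIdeal ∧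
      𝔭.asIdeal.ramificationIdx (𝓞 ℚ) = 1)
    {w : HeightOneSpectrum (𝓞 K)} (hw : ((p : ℕ) : 𝓞 K) ∈ w.asIdeal) :
    heckeValueAt (dirichletGaloisCharacter K θ) w = 0 :=
  heckeValueAt_eq_zero_of_not_isUnramifiedAt _
    (not_isUnramifiedAt_dirichletGaloisCharacter_of_mem θ ha hunr hw)

end Dirichlet

end Summit.BirchSwinnertonDyer.BirchSwinnertonDyer.Theorems.SchneiderFree

end
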